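import Summits.Ventures.PercRepro.ThetaSigmaProj

/-!
# (Σ): the oriented step, the reducible instances, and the Credit Lemma

Dossier proofs/MINE1-theoremS.md, Addendum 76 (mine-1, gen 39). At a point `e` that is not
sign-consistent the projection `projS e X` contains complementary pairs `z, (U ∖ e) ∖ z`; an
**orientation** keeps one of each — any `T ⊆ projS e X` with no complementary pair is a valid
instance on `U ∖ e`, and the bookkeeping of ThetaSigmaProj.lean survives verbatim
(`card_sigmaD_add_card_creditS_le_of_subset_projS`): `|sigmaD (U ∖ e) T| + |creditS U e X| ≤
|sigmaD U X|`. Hence the **oriented weak step** `card_le_card_sigmaD_of_subset_projS`: (Σ) for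
`T` and the count `|projS e X| + |partS e X| ≤ |T| + |creditS U e X|` (the partner pairs at `e` —
same-sign and opposite-sign alike — paid by the credit) give (Σ) for `X`.

* `SigmaReducible`, `card_le_card_sigmaD_of_sigmaReducible`, `conjSigma_of_sigmaReducible` —
  (Σ) on every valid instance reducible along such steps;
* `SigmaCreditLemma α` — **the Credit Lemma**: every valid instance on a nonempty ground set has
  a point `e` and an orientation `T` of its projection with `|projS e X| + |partS e X| ≤ |T| +
  |creditS U e X|` (exhaustively true on every ground set of at most 5 points — all 43,046,720
  labelled instances — and unbroken by annealing on 6–8 points; Addendum 76, kit j312434);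
* `sigmaValidRel_card_le_of_creditLemma`, `conjSigma_of_creditLemma` — **the Credit Lemma implies
  (Σ)** on every ground set (induction on the ground set).
-/

namespace PercRepro.MSTight

open Finset

variable {α : Type*} [DecidableEq α] [Fintype α]

section Oriented

variable {U : Finset α} {e : α} {X T : Finset (Finset α)}

omit [Fintype α] in
/-- The family of any subfamily of the projection lies in the projection of `sigmaD U X`. -/
theorem exists_erase_eq_of_mem_sigmaD_subset_projS (hT : T ⊆ projS e X) {E' : Finset α}
    (h : E' ∈ sigmaD (U.erase e) T) : ∃ E ∈ sigmaD U X, E.erase e = E' := by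
  rw [mem_sigmaD] at h
  rcases h with rfl | ⟨x', hx', y', hy', hxy', rfl⟩ | ⟨x', hx', y', hy', hxy', rfl⟩
  · exact ⟨∅, empty_mem_sigmaD U X, erase_empty e⟩
  · obtain ⟨x, hx, rfl⟩ := mem_projS.1 (hT hx')
    obtain ⟨y, hy, rfl⟩ := mem_projS.1 (hT hy')
    exact ⟨x ⊓ y, inf_mem_sigmaD (fun h => hxy' (h ▸ rfl)) hx hy, (erase_inf_erase' x y).symm⟩
  · obtain ⟨x, hx, rfl⟩ := mem_projS.1 (hT hx')
    obtain ⟨y, hy, rfl⟩ := mem_projS.1 (hT hy')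
    exact ⟨U \ (x ⊔ y), sdiff_sup_mem_sigmaD (fun h => hxy' (h ▸ rfl)) hx hy,
      (erase_sdiff_sup_erase' U x y).symm⟩

omit [Fintype α] in
/-- **The exact step for an oriented projection**: for every `T ⊆ projS e X`,
`|sigmaD (U ∖ e) T| + |creditS U e X| ≤ |sigmaD U X|`. -/
theorem card_sigmaD_add_card_creditS_le_of_subset_projS (hT : T ⊆ projS e X) :
    (sigmaD (U.erase e) T).card + (creditS U e X).card ≤ (sigmaD U X).card := by
  set D := sigmaD U X with hD
  set De' := (D.filter fun E => e ∈ E).image fun E => E.erase e with hDe'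
  set Dn := D.filter fun E => e ∉ E with hDn
  have hsplit : D.card = (D.filter fun E => e ∈ E).card + Dn.card :=
    (card_filter_add_card_filter_not (s := D) fun E => e ∈ E).symm
  have hP : sigmaD (U.erase e) T ⊆ De' ∪ Dn := by
    intro E' hE'
    obtain ⟨E, hE, rfl⟩ := exists_erase_eq_of_mem_sigmaD_subset_projS hT hE'
    rw [mem_union]
    by_cases he : e ∈ E
    · exact Or.inl (mem_image.2 ⟨E, mem_filter.2 ⟨hE, he⟩, rfl⟩)
    · rw [erase_eq_of_notMem he]
      exact Or.inr (mem_filter.2 ⟨hE, he⟩)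
  have hC : creditS U e X ⊆ De' ∩ Dn := by
    intro d hd
    obtain ⟨h1, h2, h3⟩ := mem_creditS.1 hd
    rw [mem_inter]
    exact ⟨mem_image.2 ⟨insert e d, mem_filter.2 ⟨h3, mem_insert_self e d⟩, erase_insert h2⟩,
      mem_filter.2 ⟨h1, h2⟩⟩
  calc (sigmaD (U.erase e) T).card + (creditS U e X).card
      ≤ (De' ∪ Dn).card + (De' ∩ Dn).card := Nat.add_le_add (card_le_card hP) (card_le_card hC)
    _ = De'.card + Dn.card := card_union_add_card_inter _ _
    _ = D.card := by rw [hDe', card_filter_mem_image_erase, hsplit]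

omit [Fintype α] in
/-- **The oriented weak step**: (Σ) on `U ∖ e` for an orientation `T ⊆ projS e X`, and the
partner pairs at `e` paid by the credit, give (Σ) on `U` for `X`. -/
theorem card_le_card_sigmaD_of_subset_projS (hT : T ⊆ projS e X)
    (hP : T.card ≤ (sigmaD (U.erase e) T).card)
    (hK : (projS e X).card + (partS e X).card ≤ T.card + (creditS U e X).card) :
    X.card ≤ (sigmaD U X).card :=
  calc X.card = (projS e X).card + (partS e X).card := card_projS_add_card_partS.symm
    _ ≤ T.card + (creditS U e X).card := hK
    _ ≤ (sigmaD (U.erase e) T).card + (creditS U e X).card := Nat.add_le_add_right hP _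
    _ ≤ (sigmaD U X).card := card_sigmaD_add_card_creditS_le_of_subset_projS hT

omit [Fintype α] in
/-- An orientation of the projection without complementary pairs is a valid instance on `U ∖ e`. -/
theorem sigmaValidRel_of_subset_projS (hv : SigmaValidRel U X) (hT : T ⊆ projS e X)
    (hTd : Disjoint T (complsRel (U.erase e) T)) : SigmaValidRel (U.erase e) T := by
  refine ⟨?_, hTd⟩
  intro z hz
  obtain ⟨x, hx, rfl⟩ := mem_projS.1 (hT hz)
  intro a ha
  rw [mem_erase] at ha ⊢
  exact ⟨ha.1, hv.1 x hx ha.2⟩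

end Oriented

section Reducible

/-- **Reducibility of a (Σ)-instance**: at most one member; an extreme member; a sign-consistent
point whose projection is reducible and whose partners are paid by the credit (directly, or through
a reducible partner family with `{e}` in the family or (Σ) strict for the partners); or an
oriented step at any point. -/
inductive SigmaReducible : Finset α → Finset (Finset α) → Prop
  | small {U : Finset α} {X : Finset (Finset α)} (h : X.card ≤ 1) : SigmaReducible U X
  | extreme {U : Finset α} {X : Finset (Finset α)} (h : (∅ : Finset α) ∈ X ∨ U ∈ X) :
      SigmaReducible U X
  | step {U : Finset α} {X : Finset (Finset α)} (e : α) (he : e ∈ U)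
      (hc : SigmaConsistentAt U e X) (hP : SigmaReducible (U.erase e) (projS e X))
      (hK : (partS e X).card ≤ (creditS U e X).card) : SigmaReducible U X
  | step' {U : Finset α} {X : Finset (Finset α)} (e : α) (he : e ∈ U)
      (hc : SigmaConsistentAt U e X) (hP : SigmaReducible (U.erase e) (projS e X))
      (hK : SigmaReducible (U.erase e) (partS e X))
      (h : {e} ∈ sigmaD U X ∨ (partS e X).card < (sigmaD (U.erase e) (partS e X)).card) :
      SigmaReducible U X
  | orient {U : Finset α} {X : Finset (Finset α)} (e : α) (T : Finset (Finset α))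
      (hT : T ⊆ projS e X) (hTd : Disjoint T (complsRel (U.erase e) T))
      (hP : SigmaReducible (U.erase e) T)
      (hK : (projS e X).card + (partS e X).card ≤ T.card + (creditS U e X).card) :
      SigmaReducible U X

omit [Fintype α] in
/-- **(Σ) holds for every valid reducible instance** — the weak split induction. -/
theorem card_le_card_sigmaD_of_sigmaReducible {U : Finset α} {X : Finset (Finset α)}
    (hr : SigmaReducible U X) (hv : SigmaValidRel U X) : X.card ≤ (sigmaD U X).card := by
  induction hr with
  | @small U' X' h =>
    exact h.trans (card_pos.2 ⟨∅, empty_mem_sigmaD U' X'⟩)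
  | @extreme U' X' h =>
    rcases h with h | h
    · exact card_le_card_sigmaD_of_empty_mem hv h
    · exact card_le_card_sigmaD_of_mem_self hv h
  | @step U' X' e _ hc _ hK ihP =>
    exact card_le_card_sigmaD_of_projS (ihP (sigmaValidRel_projS hv hc)) hK
  | @step' U' X' e he hc _ _ h ihP ihK =>
    exact card_le_card_sigmaD_of_projS (ihP (sigmaValidRel_projS hv hc))
      (card_partS_le_card_creditS_of he (ihK (sigmaValidRel_partS he hv)) h)
  | @orient U' X' e T hT hTd _ hK ihP =>
    exact card_le_card_sigmaD_of_subset_projS hT (ihP (sigmaValidRel_of_subset_projS hv hT hTd))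
      hK

/-- On the full ground set: the inequality of Conjecture (Σ) for every valid reducible instance. -/
theorem conjSigma_of_sigmaReducible {X : Finset (Finset α)} (hv : SigmaValidRel univ X)
    (hr : SigmaReducible univ X) : X.card ≤ (sigmaD univ X).card :=
  card_le_card_sigmaD_of_sigmaReducible hr hv

end Reducible

section CreditLemma

/-- **The Credit Lemma** (Addendum 76; a conjecture beyond ground sets of 5 points): every valid
(Σ)-instance on a nonempty ground set has a point `e` and an orientation `T` of its projection
whose partner pairs are paid by the credit. -/
def SigmaCreditLemma (α : Type*) [DecidableEq α] [Fintype α] : Prop :=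
  ∀ (U : Finset α) (X : Finset (Finset α)), SigmaValidRel U X → U.Nonempty →
    ∃ e ∈ U, ∃ T ⊆ projS e X, Disjoint T (complsRel (U.erase e) T) ∧
      (projS e X).card + (partS e X).card ≤ T.card + (creditS U e X).card

omit [Fintype α] in
/-- On the empty ground set every valid instance has at most one member. -/
theorem card_le_one_of_sigmaValidRel_empty {X : Finset (Finset α)}
    (hv : SigmaValidRel ∅ X) : X.card ≤ 1 := by
  have : X ⊆ {∅} := fun x hx => mem_singleton.2 (subset_empty.1 (hv.1 x hx))
  exact (card_le_card this).trans (card_singleton _).le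

/-- **The Credit Lemma implies (Σ) on every ground set**, by induction on the ground set. -/
theorem sigmaValidRel_card_le_of_creditLemma (h : SigmaCreditLemma α) :
    ∀ (U : Finset α) (X : Finset (Finset α)), SigmaValidRel U X → X.card ≤ (sigmaD U X).card := by
  intro U
  induction U using Finset.strongInduction with
  | H U ih =>
    intro X hv
    rcases U.eq_empty_or_nonempty with rfl | hne
    · exact (card_le_one_of_sigmaValidRel_empty hv).trans
        (card_pos.2 ⟨∅, empty_mem_sigmaD ∅ X⟩)
    · obtain ⟨e, he, T, hT, hTd, hK⟩ := h U X hv hne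
      exact card_le_card_sigmaD_of_subset_projS hT
        (ih (U.erase e) (erase_ssubset he) T (sigmaValidRel_of_subset_projS hv hT hTd)) hK

/-- **The Credit Lemma implies Conjecture (Σ).** -/
theorem conjSigma_of_creditLemma (h : SigmaCreditLemma α) : ConjSigma α :=
  fun X hv => sigmaValidRel_card_le_of_creditLemma h univ X hv

end CreditLemma

end PercRepro.MSTight
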